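import Literature.Probability.Percolation.LoopRotationInvarianceAssembly
import HarnessLib

/-!
# Rotation invariance of the critical percolation loop ensemble — the coupling form from Theorem 1.7

Sorry-free companion of `Literature.Probability.Percolation.LoopRotationInvarianceCoupling`
(statement item **crit-perc.S25**, Duminil-Copin–Kozlowski–Krachun–Manolescu–Oulamara,
*Rotational invariance in critical planar lattice models*, arXiv:2012.11672). That file proves
that a coupling of the two configuration laws under which the loop collections of `δℤ²` and
`δ e^{iα} ℤ²` are close bounds the Camia–Newman (Lévy–Prokhorov) distance of crit-perc.S25
(`dkkmo_rotation_invariance_of_coupling`); the assembly file `LoopRotationInvarianceAssembly`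
proves `dkkmo_universality_coupling → dkkmo_rotation_invariance` (Theorem 1.7 ⇒ Theorem 1.2 at
the level of laws). This file proves Theorem 1.2 (`q = 1`) **in the coupling form of DKKMO's
eq. (2)** from Theorem 1.7:

* `dkkmo_coupling_of_universality : dkkmo_universality_coupling → ∀ R, ∃ C, c > 0, ∀ α,
  ∀ δ ∈ (0, 1], ∃ P` (a coupling of two critical bond percolations on `ℤ²`) with
  `P[d_H(loops of ω on δℤ² in B̄(0,R), loops of ω' on δe^{iα}ℤ² in B̄(0,R)) > C δ^c] ≤ C δ^c`
  (proved, no other hypothesis).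

The coupling form is not kept as a separate named fact: it is equivalent to crit-perc.S25 up to
constants (couplings bound the Lévy–Prokhorov distance, and conversely by Strassen's theorem for
the finitely supported loop laws), so it carries no proof obligation of its own; the S25 cone
rests on the single named fact `dkkmo_universality_coupling` (DKKMO v2 Theorem 1.7 = v1
Theorem 2.1, the universality of critical percolation among the isoradial rectangular lattices
`L(α)`, whose printed proof is the body of the paper).

## The argument (DKKMO v1 §7.1, "Proof of Theorem 1.2, case `Ω = ℝ²`"; v2 Remark 1.8)

> "construct an explicit coupling `ℙ` between `ω_δ ∼ φ_{δL(π/2)}` and `ω'_δ ∼ φ_{δL(π/2)}` as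
> follows: sample `ω'_δ ∼ φ_{δL(π/2)}` and couple `σ_0 ω'_δ` with `ω_δ^α ∼ φ_{δL(α)}` using
> [universality] (this is doable since `σ_0 ω'_δ ∼ φ_{δL(π/2)}`), then couple `σ_{α/2} ω_δ^α`
> with `ω_δ ∼ φ_{δL(π/2)}` (this is doable since `σ_{α/2} ω_δ^α ∼ φ_{δL(α)}`) …
> `d(ω_δ, e^{iα} ω'_δ) = d(σ_{α/2} ω_δ, σ_0 ω'_δ) ≤ d(σ_{α/2} ω_δ, ω_δ^α) + d(ω_δ^α, σ_0 ω'_δ)`."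

At the level of couplings this is a *gluing* of two couplings along their common middle marginal
`φ_{δL(α)}`. Since at fixed positive mesh and bounded window the loop-collection maps take
finitely many values (`finite_range_bondLoopCollection`, `finite_range_isoRectLoopCollection`),
the elementary gluing along a finite-valued statistic suffices (`exists_glueCoupling`: first and
last coordinates conditionally independent given the loop collection of the middle configuration;
marginals `glueCoupling_map_fst/snd`, union bound through the triangle inequality
`glueCoupling_apply_le`) — no disintegration on the configuration space is needed. The exact
lattice symmetries are those proved in the assembly file (`isoRectPercolation_map_reflSite`,
`isoRectPercolation_map_swapSite`, `isoRectLoopCollection_image`), and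
`σ_{θ/2} ∘ σ_0 = e^{iθ}` on oriented loop collections (`rotate_reflectReverse_lineReflection_zero`).

* `rotationCoupling_of_isoRect`: for `θ ∈ (0, π)`, Theorem 1.7 at angle `θ` and mesh `δ` gives a
  coupling of two bond percolations on `ℤ²` whose loop collections on `√2δ ℤ²` and
  `√2δ e^{iθ} ℤ²` in `closedBall 0 R` are `2ε`-close off a set of mass `2ε`
  (`φ_{δL(π/2)}` is bond percolation read on `√2 δ e^{iπ/4} ℤ²`, `isoRectLoopCollection_pi_div_two`).
* `rotationCoupling_add`: couplings for the angles `a` and `b` glue to one for `a + b`, defects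
  adding up (glue along the loop collection on `δ e^{ia} ℤ²` of the middle configuration).
* `dkkmo_coupling_of_universality`: every real angle is, modulo `2π`, three times an angle of
  `(0, 2π/3] ⊂ (0, π)`; constants `6 max(C, 0)` and `c`.

## References

* H. Duminil-Copin, K. K. Kozlowski, D. Krachun, I. Manolescu, M. Oulamara, *Rotational
  invariance in critical planar lattice models*, arXiv:2012.11672: v1 (2020) Theorem 2.1 and
  §7.1 (proof of Theorem 1.2, case `Ω = ℝ²`); v2 (2026) Theorem 1.7, Remark 1.8.
* C. Villani, *Optimal Transport: Old and New*, Grundlehren 338, Springer (2009), Ch. 1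
  (the gluing lemma).
* R. M. Dudley, *Real Analysis and Probability*, Cambridge Univ. Press (2002), §11.8.
* G. Grimmett, *Percolation*, 2nd ed. (1999), §1.6 (lattice symmetries act on configurations).
-/

noncomputable section

open MeasureTheory Set
open scoped ENNReal Real

namespace Literature.Probability.Percolation

/-! ### Gluing two couplings along a finite-valued statistic -/

section Glue

variable {X Y Z S : Type*}

/-- The pieces `{T y = s}`, `s ∈ range T`, of the middle coordinate cover everything. [folklore] -/
theorem iUnion_inter_preimage_snd_eq {T : Y → S} (hT : (Set.range T).Finite) (A : Set (X × Y)) :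
    ⋃ s ∈ hT.toFinset, (A ∩ Prod.snd ⁻¹' (T ⁻¹' {s})) = A := by
  ext p
  simp only [mem_iUnion, mem_inter_iff, mem_preimage, mem_singleton_iff, Finite.mem_toFinset,
    mem_range, exists_prop]
  exact ⟨fun ⟨_, _, h, _⟩ => h, fun h => ⟨T p.2, ⟨p.2, rfl⟩, h, rfl⟩⟩

/-- The pieces `{T y = s}`, `s ∈ range T`, of the first coordinate cover everything. [folklore] -/
theorem iUnion_inter_preimage_fst_eq {T : Y → S} (hT : (Set.range T).Finite) (B : Set (Y × Z)) :
    ⋃ s ∈ hT.toFinset, (B ∩ Prod.fst ⁻¹' (T ⁻¹' {s})) = B := by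
  ext p
  simp only [mem_iUnion, mem_inter_iff, mem_preimage, mem_singleton_iff, Finite.mem_toFinset,
    mem_range, exists_prop]
  exact ⟨fun ⟨_, _, h, _⟩ => h, fun h => ⟨T p.1, ⟨p.1, rfl⟩, h, rfl⟩⟩

/-- A horizontal cylinder is a rectangle. [folklore] -/
theorem preimage_fst_eq_prod_univ (A : Set X) : (Prod.fst ⁻¹' A : Set (X × Z)) = A ×ˢ univ := by
  ext p; simp

/-- A vertical cylinder is a rectangle. [folklore] -/
theorem preimage_snd_eq_univ_prod (B : Set Z) : (Prod.snd ⁻¹' B : Set (X × Z)) = univ ×ˢ B := by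
  ext p; simp

variable [MeasurableSpace X] [MeasurableSpace Y] [MeasurableSpace Z] [MeasurableSpace S]

/-- `m⁻¹ (p m) = p` in `ℝ≥0∞` for `p ≤ m < ∞` (also when `m = 0`). [folklore] -/
theorem ennreal_inv_mul_mul_cancel_of_le {m p : ℝ≥0∞} (hp : p ≤ m) (hm : m ≠ ∞) :
    m⁻¹ * (p * m) = p := by
  rcases eq_or_ne m 0 with rfl | h0
  · rw [nonpos_iff_eq_zero.1 hp]; simp
  · rw [mul_left_comm, ENNReal.inv_mul_cancel h0 hm, mul_one]

/-- `m⁻¹ (m p) = p` in `ℝ≥0∞` for `p ≤ m < ∞` (also when `m = 0`). [folklore] -/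
theorem ennreal_inv_mul_mul_cancel_of_le' {m p : ℝ≥0∞} (hp : p ≤ m) (hm : m ≠ ∞) :
    m⁻¹ * (m * p) = p := by
  rw [mul_comm m p]; exact ennreal_inv_mul_mul_cancel_of_le hp hm

variable [MeasurableSingletonClass S]

/-- **Gluing of couplings along a finite-valued statistic: first marginal.** Given a coupling
`P₁` on `X × Y`, a coupling `P₂` on `Y × Z` with the same middle marginal `ν`, and a statistic
`T : Y → S` with finitely many values, the *glued coupling* on `X × Z` — first and last
coordinates conditionally independent given the value of `T` on the middle coordinate,
`∑ₛ ν(T = s)⁻¹ · (law of x on {T y = s} under P₁) ⊗ (law of z on {T y = s} under P₂)` — has the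
`X`-marginal of `P₁` as first marginal. This is the elementary (finite conditioning) case of the
gluing lemma. (Villani, *Optimal Transport: Old and New* (2009), Ch. 1, "Gluing lemma"; Dudley,
*Real Analysis and Probability* (2002), §11.8.) [folklore] -/
theorem glueCoupling_map_fst (P₁ : Measure (X × Y)) (P₂ : Measure (Y × Z)) [IsFiniteMeasure P₁]
    [IsFiniteMeasure P₂] {T : Y → S} (hTm : Measurable T) (hT : (Set.range T).Finite)
    (hν : P₁.map Prod.snd = P₂.map Prod.fst) :
    (∑ s ∈ hT.toFinset, ((P₁.map Prod.snd) (T ⁻¹' {s}))⁻¹ •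
      ((P₁.restrict (Prod.snd ⁻¹' (T ⁻¹' {s}))).map Prod.fst).prod
        ((P₂.restrict (Prod.fst ⁻¹' (T ⁻¹' {s}))).map Prod.snd)).map Prod.fst = P₁.map Prod.fst := by
  ext A hA
  rw [Measure.map_apply measurable_fst hA, Measure.map_apply measurable_fst hA,
    Measure.finsetSum_apply]
  have hS : ∀ s, MeasurableSet (T ⁻¹' {s} : Set Y) := fun s => hTm (measurableSet_singleton s)
  have hterm : ∀ s ∈ hT.toFinset,
      (((P₁.map Prod.snd) (T ⁻¹' {s}))⁻¹ •
        ((P₁.restrict (Prod.snd ⁻¹' (T ⁻¹' {s}))).map Prod.fst).prod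
          ((P₂.restrict (Prod.fst ⁻¹' (T ⁻¹' {s}))).map Prod.snd)) (Prod.fst ⁻¹' A) =
      P₁ (Prod.fst ⁻¹' A ∩ Prod.snd ⁻¹' (T ⁻¹' {s})) := by
    intro s _
    rw [Measure.smul_apply, smul_eq_mul, preimage_fst_eq_prod_univ A, Measure.prod_prod,
      Measure.map_apply measurable_fst hA, Measure.restrict_apply (measurable_fst hA),
      Measure.map_apply measurable_snd MeasurableSet.univ, Set.preimage_univ,
      Measure.restrict_apply_univ, ← Measure.map_apply measurable_fst (hS s), ← hν,
      Measure.map_apply measurable_snd (hS s)]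
    exact ennreal_inv_mul_mul_cancel_of_le (measure_mono Set.inter_subset_right) (measure_ne_top _ _)
  rw [Finset.sum_congr rfl hterm, ← measure_biUnion_finset, iUnion_inter_preimage_snd_eq]
  · intro s _ t _ hst
    refine Set.disjoint_left.2 fun p hp hp' => hst ?_
    exact hp.2.symm.trans hp'.2
  · exact fun s _ => (measurable_fst hA).inter (measurable_snd (hS s))

/-- **Gluing of couplings along a finite-valued statistic: second marginal** (the `Z`-marginal of
`P₂`). (Villani 2009, Ch. 1, Gluing lemma.) [folklore] -/
theorem glueCoupling_map_snd (P₁ : Measure (X × Y)) (P₂ : Measure (Y × Z)) [IsFiniteMeasure P₁]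
    [IsFiniteMeasure P₂] {T : Y → S} (hTm : Measurable T) (hT : (Set.range T).Finite)
    (hν : P₁.map Prod.snd = P₂.map Prod.fst) :
    (∑ s ∈ hT.toFinset, ((P₁.map Prod.snd) (T ⁻¹' {s}))⁻¹ •
      ((P₁.restrict (Prod.snd ⁻¹' (T ⁻¹' {s}))).map Prod.fst).prod
        ((P₂.restrict (Prod.fst ⁻¹' (T ⁻¹' {s}))).map Prod.snd)).map Prod.snd = P₂.map Prod.snd := by
  ext B hB
  rw [Measure.map_apply measurable_snd hB, Measure.map_apply measurable_snd hB,
    Measure.finsetSum_apply]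
  have hS : ∀ s, MeasurableSet (T ⁻¹' {s} : Set Y) := fun s => hTm (measurableSet_singleton s)
  have hterm : ∀ s ∈ hT.toFinset,
      (((P₁.map Prod.snd) (T ⁻¹' {s}))⁻¹ •
        ((P₁.restrict (Prod.snd ⁻¹' (T ⁻¹' {s}))).map Prod.fst).prod
          ((P₂.restrict (Prod.fst ⁻¹' (T ⁻¹' {s}))).map Prod.snd)) (Prod.snd ⁻¹' B) =
      P₂ (Prod.snd ⁻¹' B ∩ Prod.fst ⁻¹' (T ⁻¹' {s})) := by
    intro s _
    rw [Measure.smul_apply, smul_eq_mul, preimage_snd_eq_univ_prod B, Measure.prod_prod,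
      Measure.map_apply measurable_snd hB, Measure.restrict_apply (measurable_snd hB),
      Measure.map_apply measurable_fst MeasurableSet.univ, Set.preimage_univ,
      Measure.restrict_apply_univ, ← Measure.map_apply measurable_snd (hS s)]
    refine ennreal_inv_mul_mul_cancel_of_le' ?_ (measure_ne_top _ _)
    rw [hν, Measure.map_apply measurable_fst (hS s)]
    exact measure_mono Set.inter_subset_right
  rw [Finset.sum_congr rfl hterm, ← measure_biUnion_finset, iUnion_inter_preimage_fst_eq]
  · intro s _ t _ hst
    refine Set.disjoint_left.2 fun p hp hp' => hst ?_
    exact hp.2.symm.trans hp'.2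
  · exact fun s _ => (measurable_snd hB).inter (measurable_fst (hS s))

variable [PseudoEMetricSpace S] [OpensMeasurableSpace S]

/-- **The glued coupling adds the defects.** If under `P₁` the statistics `F x` and `T y` are
more than `a` apart with (outer) probability `p`, and under `P₂` the statistics `T y` and `H z`
are more than `b` apart with probability `q`, then under the glued coupling `F x` and `H z` are
more than `a + b` apart with probability at most `p + q` (triangle inequality through the common
value of `T`). (Villani 2009, Ch. 1; DKKMO, arXiv:2012.11672, proof of Theorem 1.2.) [folklore] -/
theorem glueCoupling_apply_le (P₁ : Measure (X × Y)) (P₂ : Measure (Y × Z)) [IsFiniteMeasure P₁]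
    [IsFiniteMeasure P₂] {T : Y → S} (hTm : Measurable T) (hT : (Set.range T).Finite)
    (hν : P₁.map Prod.snd = P₂.map Prod.fst) {F : X → S} {H : Z → S} (hF : Measurable F)
    (hH : Measurable H) (a b : ℝ≥0∞) :
    (∑ s ∈ hT.toFinset, ((P₁.map Prod.snd) (T ⁻¹' {s}))⁻¹ •
      ((P₁.restrict (Prod.snd ⁻¹' (T ⁻¹' {s}))).map Prod.fst).prod
        ((P₂.restrict (Prod.fst ⁻¹' (T ⁻¹' {s}))).map Prod.snd))
        {p | a + b < edist (F p.1) (H p.2)} ≤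
      P₁ {p | a < edist (F p.1) (T p.2)} + P₂ {p | b < edist (T p.1) (H p.2)} := by
  have hS : ∀ s, MeasurableSet (T ⁻¹' {s} : Set Y) := fun s => hTm (measurableSet_singleton s)
  -- the measurable one-coordinate events through the value `s` of the statistic
  set A : S → Set X := fun s => {x | a < edist (F x) s} with hAdef
  set B : S → Set Z := fun s => {z | b < edist s (H z)} with hBdef
  have hAm : ∀ s, MeasurableSet (A s) := fun s =>
    measurableSet_lt measurable_const ((continuous_id.edist continuous_const).measurable.comp hF)
  have hBm : ∀ s, MeasurableSet (B s) := fun s =>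
    measurableSet_lt measurable_const ((continuous_const.edist continuous_id).measurable.comp hH)
  have hsub : ∀ s, {p : X × Z | a + b < edist (F p.1) (H p.2)} ⊆ A s ×ˢ univ ∪ univ ×ˢ B s := by
    intro s p hp
    by_contra h
    simp only [mem_union, mem_prod, mem_univ, and_true, true_and, not_or, hAdef, hBdef,
      mem_setOf_eq, not_lt] at h
    exact (lt_irrefl _) (hp.trans_le ((edist_triangle _ s _).trans (add_le_add h.1 h.2)))
  rw [Measure.finsetSum_apply]
  have hterm : ∀ s ∈ hT.toFinset,
      (((P₁.map Prod.snd) (T ⁻¹' {s}))⁻¹ •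
        ((P₁.restrict (Prod.snd ⁻¹' (T ⁻¹' {s}))).map Prod.fst).prod
          ((P₂.restrict (Prod.fst ⁻¹' (T ⁻¹' {s}))).map Prod.snd))
          {p | a + b < edist (F p.1) (H p.2)} ≤
      P₁ (Prod.fst ⁻¹' A s ∩ Prod.snd ⁻¹' (T ⁻¹' {s})) +
        P₂ (Prod.snd ⁻¹' B s ∩ Prod.fst ⁻¹' (T ⁻¹' {s})) := by
    intro s _
    have hm : (P₁.map Prod.snd) (T ⁻¹' {s}) = P₁ (Prod.snd ⁻¹' (T ⁻¹' {s})) :=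
      Measure.map_apply measurable_snd (hS s)
    have hm' : (P₁.map Prod.snd) (T ⁻¹' {s}) = P₂ (Prod.fst ⁻¹' (T ⁻¹' {s})) := by
      rw [hν, Measure.map_apply measurable_fst (hS s)]
    rw [Measure.smul_apply, smul_eq_mul]
    refine (mul_le_mul' le_rfl ((measure_mono (hsub s)).trans (measure_union_le _ _))).trans ?_
    rw [Measure.prod_prod, Measure.prod_prod, Measure.map_apply measurable_fst (hAm s),
      Measure.restrict_apply (measurable_fst (hAm s)), Measure.map_apply measurable_snd (hBm s),
      Measure.restrict_apply (measurable_snd (hBm s)),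
      Measure.map_apply measurable_snd MeasurableSet.univ, Set.preimage_univ,
      Measure.restrict_apply_univ, Measure.map_apply measurable_fst MeasurableSet.univ,
      Set.preimage_univ, Measure.restrict_apply_univ, mul_add, ← hm', ← hm]
    refine add_le_add (le_of_eq ?_) (le_of_eq ?_)
    · exact ennreal_inv_mul_mul_cancel_of_le (hm ▸ measure_mono Set.inter_subset_right)
        (measure_ne_top _ _)
    · exact ennreal_inv_mul_mul_cancel_of_le' (hm' ▸ measure_mono Set.inter_subset_right)
        (measure_ne_top _ _)
  refine (Finset.sum_le_sum hterm).trans ?_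
  rw [Finset.sum_add_distrib, ← measure_biUnion_finset, ← measure_biUnion_finset]
  · refine add_le_add (measure_mono ?_) (measure_mono ?_)
    · simp only [iUnion_subset_iff]
      rintro s - p ⟨hp, hps⟩
      have hps : T p.2 = s := hps
      rw [mem_setOf_eq, hps]; exact hp
    · simp only [iUnion_subset_iff]
      rintro s - p ⟨hp, hps⟩
      have hps : T p.1 = s := hps
      rw [mem_setOf_eq, hps]; exact hp
  · intro s _ t _ hst
    refine Set.disjoint_left.2 fun p hp hp' => hst ?_
    exact hp.2.symm.trans hp'.2
  · exact fun s _ => (measurable_snd (hBm s)).inter (measurable_fst (hS s))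
  · intro s _ t _ hst
    refine Set.disjoint_left.2 fun p hp hp' => hst ?_
    exact hp.2.symm.trans hp'.2
  · exact fun s _ => (measurable_fst (hAm s)).inter (measurable_snd (hS s))

/-- **Gluing lemma (finite-valued statistic).** Two couplings `P₁` on `X × Y` and `P₂` on
`Y × Z` with a common middle marginal glue to a coupling `Q` on `X × Z` of the outer marginals
under which defects measured through a finite-valued measurable statistic `T` of the middle
coordinate add up: `Q[a + b < d(F x, H z)] ≤ P₁[a < d(F x, T y)] + P₂[b < d(T y, H z)]`
(triangle inequality; outer measures, no measurability of the events needed).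
(Villani, *Optimal Transport: Old and New* (2009), Ch. 1, "Gluing lemma".) [folklore] -/
theorem exists_glueCoupling (P₁ : Measure (X × Y)) (P₂ : Measure (Y × Z)) [IsFiniteMeasure P₁]
    [IsFiniteMeasure P₂] {T : Y → S} (hTm : Measurable T) (hT : (Set.range T).Finite)
    (hν : P₁.map Prod.snd = P₂.map Prod.fst) :
    ∃ Q : Measure (X × Z), Q.map Prod.fst = P₁.map Prod.fst ∧ Q.map Prod.snd = P₂.map Prod.snd ∧
      ∀ {F : X → S} {H : Z → S}, Measurable F → Measurable H → ∀ a b : ℝ≥0∞,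
        Q {p | a + b < edist (F p.1) (H p.2)} ≤
          P₁ {p | a < edist (F p.1) (T p.2)} + P₂ {p | b < edist (T p.1) (H p.2)} :=
  ⟨_, glueCoupling_map_fst P₁ P₂ hTm hT hν, glueCoupling_map_snd P₁ P₂ hTm hT hν,
    fun hF hH a b ↦ glueCoupling_apply_le P₁ P₂ hTm hT hν hF hH a b⟩

end Glue

/-! ### Couplings of percolation configurations: bookkeeping -/

section Config

open LatticeModels

variable {X Y : Type*} [MeasurableSpace X] [MeasurableSpace Y]

/-- A measure on a product whose first marginal is a probability measure is a probability
measure. [folklore] -/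
theorem isProbabilityMeasure_of_map_fst_eq {P : Measure (X × Y)} {μ : Measure X}
    [IsProbabilityMeasure μ] (h : P.map Prod.fst = μ) : IsProbabilityMeasure P := by
  have : IsProbabilityMeasure (P.map Prod.fst) := by rw [h]; infer_instance
  exact Measure.isProbabilityMeasure_of_map Prod.fst

/-- A linear isometry of the plane preserves the centred closed balls. [folklore] -/
theorem mem_closedBall_zero_map_iff (S : ℂ ≃ₗᵢ[ℝ] ℂ) (R : ℝ) (z : ℂ) :
    S z ∈ Metric.closedBall (0 : ℂ) R ↔ z ∈ Metric.closedBall (0 : ℂ) R := by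
  simp [Metric.mem_closedBall, dist_zero_right]

/-- A loop-collection-valued map `ω ↦ closure (F '' {γ | IsInterfaceLoop ω γ ∧ P γ})` takes only
finitely many values as soon as only finitely many lists `γ` can occur (it factors through the
subsets of the finite candidate set). (Camia–Newman, CMP 268 (2006), §2.) [folklore] -/
theorem finite_range_loopCollection (F : List MedialVertex → RandomPlanarGeometry.CurveClass ℂ)
    (P : List MedialVertex → Prop)
    (hfin : {γ : List MedialVertex | (∃ ω, IsInterfaceLoop ω γ) ∧ P γ}.Finite) :
    (Set.range fun ω : BondConfig (Site 2) ↦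
      (⟨closure (F '' {γ | IsInterfaceLoop ω γ ∧ P γ}), isClosed_closure⟩ :
        RandomPlanarGeometry.LoopSpace ℂ)).Finite := by
  refine (hfin.finite_subsets.image fun A ↦
    (⟨closure (F '' A), isClosed_closure⟩ : RandomPlanarGeometry.LoopSpace ℂ)).subset ?_
  rintro _ ⟨ω, rfl⟩
  exact ⟨{γ | IsInterfaceLoop ω γ ∧ P γ}, fun γ hγ ↦ ⟨⟨ω, hγ.1⟩, hγ.2⟩, rfl⟩

/-- At positive mesh and in a bounded window the loop-collection map of `δ e^{iα} ℤ²` takes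
finitely many values. (Camia–Newman, CMP 268 (2006), §2.) [folklore] -/
theorem finite_range_bondLoopCollection {δ : ℝ} (hδ : 0 < δ) (α : ℝ) {Λ : Set ℂ}
    (hΛ : Bornology.IsBounded Λ) : (Set.range (bondLoopCollection δ α Λ)).Finite :=
  finite_range_loopCollection _ _ (finite_setOf_exists_isInterfaceLoop hδ α hΛ)

/-- At positive mesh and in a bounded window the loop-collection map of `δ L(α)` takes finitely
many values. (Camia–Newman, CMP 268 (2006), §2.) [folklore] -/
theorem finite_range_isoRectLoopCollection {δ : ℝ} (hδ : 0 < δ) {α : ℝ} (hα : α ∈ Set.Ioo 0 π)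
    {Λ : Set ℂ} (hΛ : Bornology.IsBounded Λ) : (Set.range (isoRectLoopCollection δ α Λ)).Finite :=
  finite_range_loopCollection _ _ (finite_setOf_exists_isInterfaceLoop_isoRect hδ hα hΛ)

/-- `R_θ ∘ Ψ_0 = Ψ_θ` on oriented loop collections, where `Ψ_θ` is reflect-and-reverse in the line
`e^{iθ/2}ℝ` and `R_θ` the rotation by `θ` (DKKMO, Remark 1.8: two reflections compose to a
rotation; the two time reversals cancel). [cite: arXiv201211672v2, Remark 1.8] -/
theorem rotate_reflectReverse_lineReflection_zero (θ : ℝ) (M : RandomPlanarGeometry.LoopSpace ℂ) :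
    RandomPlanarGeometry.LoopSpace.rotate θ
        (RandomPlanarGeometry.LoopSpace.reflectReverse (RandomPlanarGeometry.lineReflection 0) M) =
      RandomPlanarGeometry.LoopSpace.reflectReverse (RandomPlanarGeometry.lineReflection (θ / 2)) M := by
  calc RandomPlanarGeometry.LoopSpace.rotate θ
        (RandomPlanarGeometry.LoopSpace.reflectReverse (RandomPlanarGeometry.lineReflection 0) M)
      = RandomPlanarGeometry.LoopSpace.reflectReverse (RandomPlanarGeometry.lineReflection (θ / 2))
          (RandomPlanarGeometry.LoopSpace.reflectReverse (RandomPlanarGeometry.lineReflection 0)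
            (RandomPlanarGeometry.LoopSpace.reflectReverse (RandomPlanarGeometry.lineReflection 0) M)) := by
        rw [RandomPlanarGeometry.LoopSpace.reflectReverse_lineReflection_zero,
          show (2 : ℝ) * (θ / 2) = θ by ring]
    _ = RandomPlanarGeometry.LoopSpace.reflectReverse (RandomPlanarGeometry.lineReflection (θ / 2)) M := by
        rw [RandomPlanarGeometry.LoopSpace.reflectReverse_reflectReverse_self
          (RandomPlanarGeometry.lineReflection_lineReflection 0)]

end Config

/-! ### Remark 1.8 in coupling form -/

section CritPerc

open LatticeModels

/-- **One base angle.** From a coupling of `φ_{δL(θ)}` and `φ_{δL(π/2)}` whose `L(θ)`- and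
`L(π/2)`-loop collections in `closedBall 0 R` are `ε`-close off a set of mass `≤ ε`
(Theorem 1.7 at the angle `θ ∈ (0, π)`), a coupling of two critical bond percolations on `ℤ²`
whose loop collections, drawn on `√2δ ℤ²` and on `√2δ e^{iθ} ℤ²`, are `2ε`-close off a set of
mass `≤ 2ε`. This is the proof of Theorem 1.2 (case `Ω = ℝ²`) of DKKMO: sample `ω'`, couple
`σ₀ ω'` with `ω^θ ∼ φ_{δL(θ)}`, then couple `σ_{θ/2} ω^θ` with `ω`; here the two couplings
(obtained from the given one by the exact lattice symmetries `isoRectPercolation_map_reflSite`,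
`isoRectLoopCollection_image`) are glued along the finite-valued statistic "loop collection of
`ω^θ`" (`exists_glueCoupling`), and `σ_{θ/2} ∘ σ₀` is the rotation by `θ`
(`rotate_reflectReverse_lineReflection_zero`); `φ_{δL(π/2)}` is bond percolation on
`√2 δ e^{iπ/4} ℤ²` (`isoRectLoopCollection_pi_div_two`). (DKKMO, arXiv:2012.11672, v1 §7.1 proof of
Theorem 1.2 / v2 Remark 1.8.) [cite: arXiv201211672v2, Remark 1.8] -/
theorem rotationCoupling_of_isoRect {δ : ℝ} (hδ : 0 < δ) {θ : ℝ} (hθ : θ ∈ Set.Ioo 0 π) (R : ℝ)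
    {ε : ℝ≥0∞}
    (h : ∃ P : Measure (BondConfig (Site 2) × BondConfig (Site 2)),
      P.map Prod.fst = isoRectPercolation θ ∧ P.map Prod.snd = isoRectPercolation (π / 2) ∧
      P {p | ε < edist (isoRectLoopCollection δ θ (Metric.closedBall 0 R) p.1)
        (isoRectLoopCollection δ (π / 2) (Metric.closedBall 0 R) p.2)} ≤ ε) :
    ∃ P : Measure (BondConfig (Site 2) × BondConfig (Site 2)),
      P.map Prod.fst = bondPercolation (zdGraph 2) half ∧
      P.map Prod.snd = bondPercolation (zdGraph 2) half ∧
      P {p | ε + ε < edist (bondLoopCollection (Real.sqrt 2 * δ) 0 (Metric.closedBall 0 R) p.1)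
        (bondLoopCollection (Real.sqrt 2 * δ) θ (Metric.closedBall 0 R) p.2)} ≤ ε + ε := by
  obtain ⟨P, h₁, h₂, hP⟩ := h
  have hb : Bornology.IsBounded (Metric.closedBall (0 : ℂ) R) := Metric.isBounded_closedBall
  have hpi : π / 2 ∈ Set.Ioo (0 : ℝ) π := ⟨by positivity, by linarith [Real.pi_pos]⟩
  have hmθ : Measurable (isoRectLoopCollection δ θ (Metric.closedBall (0 : ℂ) R)) :=
    measurable_isoRectLoopCollection hδ hθ hb
  have hmL : Measurable (isoRectLoopCollection δ (π / 2) (Metric.closedBall (0 : ℂ) R)) :=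
    measurable_isoRectLoopCollection hδ hpi hb
  have hfin : (Set.range (isoRectLoopCollection δ θ (Metric.closedBall (0 : ℂ) R))).Finite :=
    finite_range_isoRectLoopCollection hδ hθ hb
  have hΨm : Measurable fun ω ↦ RandomPlanarGeometry.LoopSpace.reflectReverse
      (RandomPlanarGeometry.lineReflection (θ / 2)) (isoRectLoopCollection δ (π / 2) (Metric.closedBall (0 : ℂ) R) ω) :=
    (RandomPlanarGeometry.LoopSpace.measurable_reflectReverse _).comp hmL
  haveI : IsProbabilityMeasure P := isProbabilityMeasure_of_map_fst_eq h₁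
  -- the exact symmetries at the level of configurations
  have hrefl : ∀ ω : BondConfig (Site 2),
      isoRectLoopCollection δ θ (Metric.closedBall (0 : ℂ) R) (reflPerm '' ω) =
        RandomPlanarGeometry.LoopSpace.reflectReverse (RandomPlanarGeometry.lineReflection (θ / 2))
          (isoRectLoopCollection δ θ (Metric.closedBall (0 : ℂ) R) ω) := fun ω ↦
    isoRectLoopCollection_image isLatticeReflection_reflSite (isoRectMedialPoint_map_reflSite δ θ)
      (mem_closedBall_zero_map_iff _ R) ω
  have hswap : ∀ ω : BondConfig (Site 2),
      isoRectLoopCollection δ (π / 2) (Metric.closedBall (0 : ℂ) R) (swapPerm '' ω) =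
        RandomPlanarGeometry.LoopSpace.reflectReverse (RandomPlanarGeometry.lineReflection 0)
          (isoRectLoopCollection δ (π / 2) (Metric.closedBall (0 : ℂ) R) ω) := fun ω ↦
    isoRectLoopCollection_image isLatticeReflection_swapSite (isoRectMedialPoint_map_swapSite δ)
      (mem_closedBall_zero_map_iff _ R) ω
  -- coupling 1: `(x, y) := (p.2, p.1)`; coupling 2: `(y, z) := (reflPerm '' p.1, p.2)`
  let e₁ : BondConfig (Site 2) × BondConfig (Site 2) ≃ᵐ BondConfig (Site 2) × BondConfig (Site 2) :=
    MeasurableEquiv.prodComm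
  let ρr : BondConfig (Site 2) ≃ᵐ BondConfig (Site 2) :=
    ⟨Equiv.Set.congr reflPerm, measurable_image_equiv _, measurable_image_equiv _⟩
  let e₂ : BondConfig (Site 2) × BondConfig (Site 2) ≃ᵐ BondConfig (Site 2) × BondConfig (Site 2) :=
    MeasurableEquiv.prodCongr ρr (MeasurableEquiv.refl _)
  haveI : IsProbabilityMeasure (P.map e₁) :=
    Measure.isProbabilityMeasure_map e₁.measurable.aemeasurable
  haveI : IsProbabilityMeasure (P.map e₂) :=
    Measure.isProbabilityMeasure_map e₂.measurable.aemeasurable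
  have hP₁fst : (P.map e₁).map Prod.fst = isoRectPercolation (π / 2) := by
    rw [Measure.map_map measurable_fst e₁.measurable]
    have : Prod.fst ∘ ⇑e₁ = Prod.snd := rfl
    rw [this]; exact h₂
  have hP₁snd : (P.map e₁).map Prod.snd = isoRectPercolation θ := by
    rw [Measure.map_map measurable_snd e₁.measurable]
    have : Prod.snd ∘ ⇑e₁ = Prod.fst := rfl
    rw [this]; exact h₁
  have hP₂fst : (P.map e₂).map Prod.fst = isoRectPercolation θ := by
    rw [Measure.map_map measurable_fst e₂.measurable]
    have : Prod.fst ∘ ⇑e₂ = (fun ω : BondConfig (Site 2) ↦ reflPerm '' ω) ∘ Prod.fst := rfl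
    rw [this, ← Measure.map_map (measurable_image_equiv reflPerm) measurable_fst, h₁,
      isoRectPercolation_map_reflSite]
  have hP₂snd : (P.map e₂).map Prod.snd = isoRectPercolation (π / 2) := by
    rw [Measure.map_map measurable_snd e₂.measurable]
    have : Prod.snd ∘ ⇑e₂ = Prod.snd := rfl
    rw [this]; exact h₂
  have hν : (P.map e₁).map Prod.snd = (P.map e₂).map Prod.fst := by rw [hP₁snd, hP₂fst]
  -- their defects
  have hd₁ : (P.map e₁) {p | ε < edist (isoRectLoopCollection δ (π / 2) (Metric.closedBall (0 : ℂ) R) p.1)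
      (isoRectLoopCollection δ θ (Metric.closedBall (0 : ℂ) R) p.2)} ≤ ε := by
    rw [MeasurableEquiv.map_apply]
    refine (measure_mono fun p hp ↦ ?_).trans hP
    have hp' : ε < edist (isoRectLoopCollection δ (π / 2) (Metric.closedBall (0 : ℂ) R) p.2)
        (isoRectLoopCollection δ θ (Metric.closedBall (0 : ℂ) R) p.1) := hp
    show ε < edist _ _
    rwa [edist_comm]
  have hd₂ : (P.map e₂) {p | ε < edist (isoRectLoopCollection δ θ (Metric.closedBall (0 : ℂ) R) p.1)
      (RandomPlanarGeometry.LoopSpace.reflectReverse (RandomPlanarGeometry.lineReflection (θ / 2))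
        (isoRectLoopCollection δ (π / 2) (Metric.closedBall (0 : ℂ) R) p.2))} ≤ ε := by
    rw [MeasurableEquiv.map_apply]
    refine (measure_mono fun p hp ↦ ?_).trans hP
    have hp' : ε < edist (isoRectLoopCollection δ θ (Metric.closedBall (0 : ℂ) R) (reflPerm '' p.1))
        (RandomPlanarGeometry.LoopSpace.reflectReverse (RandomPlanarGeometry.lineReflection (θ / 2))
          (isoRectLoopCollection δ (π / 2) (Metric.closedBall (0 : ℂ) R) p.2)) := hp
    show ε < edist _ _
    rwa [hrefl, (RandomPlanarGeometry.LoopSpace.isometry_reflectReverse _).edist_eq] at hp'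
  -- glue them along the loop collection of the `L(θ)` configuration
  obtain ⟨Q, hQfst, hQsnd, hQ⟩ := exists_glueCoupling (P.map e₁) (P.map e₂) hmθ hfin hν
  rw [hP₁fst] at hQfst
  rw [hP₂snd] at hQsnd
  have hQd : Q {q | ε + ε < edist (isoRectLoopCollection δ (π / 2) (Metric.closedBall (0 : ℂ) R) q.1)
        (RandomPlanarGeometry.LoopSpace.reflectReverse (RandomPlanarGeometry.lineReflection (θ / 2))
          (isoRectLoopCollection δ (π / 2) (Metric.closedBall (0 : ℂ) R) q.2))} ≤ ε + ε :=
    (hQ hmL hΨm ε ε).trans (add_le_add hd₁ hd₂)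
  -- undo the reflection of the last coordinate: `σ_{θ/2} ∘ σ₀` is the rotation by `θ`
  have key : ∀ x z : BondConfig (Site 2),
      edist (bondLoopCollection (Real.sqrt 2 * δ) 0 (Metric.closedBall (0 : ℂ) R) x)
          (bondLoopCollection (Real.sqrt 2 * δ) θ (Metric.closedBall (0 : ℂ) R) (swapPerm '' z)) =
        edist (isoRectLoopCollection δ (π / 2) (Metric.closedBall (0 : ℂ) R) x)
          (RandomPlanarGeometry.LoopSpace.reflectReverse (RandomPlanarGeometry.lineReflection (θ / 2))
            (isoRectLoopCollection δ (π / 2) (Metric.closedBall (0 : ℂ) R) z)) := by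
    intro x z
    rw [← (RandomPlanarGeometry.LoopSpace.isometry_rotate (π / 4)).edist_eq, ← bondLoopCollection_add,
      ← bondLoopCollection_add, add_zero, add_comm (π / 4) θ, bondLoopCollection_add _ θ (π / 4),
      ← isoRectLoopCollection_pi_div_two, ← isoRectLoopCollection_pi_div_two, hswap,
      rotate_reflectReverse_lineReflection_zero]
  let ρs : BondConfig (Site 2) ≃ᵐ BondConfig (Site 2) :=
    ⟨Equiv.Set.congr swapPerm, measurable_image_equiv _, measurable_image_equiv _⟩
  let e₃ : BondConfig (Site 2) × BondConfig (Site 2) ≃ᵐ BondConfig (Site 2) × BondConfig (Site 2) :=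
    MeasurableEquiv.prodCongr (MeasurableEquiv.refl _) ρs
  refine ⟨Q.map e₃, ?_, ?_, ?_⟩
  · rw [Measure.map_map measurable_fst e₃.measurable]
    have : Prod.fst ∘ ⇑e₃ = Prod.fst := rfl
    rw [this, hQfst, isoRectPercolation_pi_div_two]
  · rw [Measure.map_map measurable_snd e₃.measurable]
    have : Prod.snd ∘ ⇑e₃ = (fun ω : BondConfig (Site 2) ↦ swapPerm '' ω) ∘ Prod.snd := rfl
    rw [this, ← Measure.map_map (measurable_image_equiv swapPerm) measurable_snd, hQsnd,
      isoRectPercolation_map_swapSite, isoRectPercolation_pi_div_two]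
  · rw [MeasurableEquiv.map_apply]
    refine (measure_mono fun q hq ↦ ?_).trans hQd
    have hq' : ε + ε < edist (bondLoopCollection (Real.sqrt 2 * δ) 0 (Metric.closedBall (0 : ℂ) R) q.1)
        (bondLoopCollection (Real.sqrt 2 * δ) θ (Metric.closedBall (0 : ℂ) R) (swapPerm '' q.2)) := hq
    show ε + ε < edist _ _
    rwa [key] at hq'

/-- **Angle addition for couplings.** Couplings of critical percolation on `δℤ²` with itself whose
loop collections on `δℤ²` / `δe^{ia}ℤ²` (resp. `δℤ²` / `δe^{ib}ℤ²`) are `ε₁`- (resp. `ε₂`-) close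
off sets of mass `ε₁` (resp. `ε₂`) glue — along the finite-valued loop collection on `δe^{ia}ℤ²`
of the middle configuration, after rotating the second coupling by `a` — to a coupling for the
angle `a + b` with defect `ε₁ + ε₂`. (DKKMO, arXiv:2012.11672, proof of Theorem 1.2; Villani
2009, Ch. 1, Gluing lemma.) [folklore] -/
theorem rotationCoupling_add {δ : ℝ} (hδ : 0 < δ) (R a b : ℝ) {ε₁ ε₂ : ℝ≥0∞}
    (h₁ : ∃ P : Measure (BondConfig (Site 2) × BondConfig (Site 2)),
      P.map Prod.fst = bondPercolation (zdGraph 2) half ∧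
      P.map Prod.snd = bondPercolation (zdGraph 2) half ∧
      P {p | ε₁ < edist (bondLoopCollection δ 0 (Metric.closedBall 0 R) p.1)
        (bondLoopCollection δ a (Metric.closedBall 0 R) p.2)} ≤ ε₁)
    (h₂ : ∃ P : Measure (BondConfig (Site 2) × BondConfig (Site 2)),
      P.map Prod.fst = bondPercolation (zdGraph 2) half ∧
      P.map Prod.snd = bondPercolation (zdGraph 2) half ∧
      P {p | ε₂ < edist (bondLoopCollection δ 0 (Metric.closedBall 0 R) p.1)
        (bondLoopCollection δ b (Metric.closedBall 0 R) p.2)} ≤ ε₂) :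
    ∃ P : Measure (BondConfig (Site 2) × BondConfig (Site 2)),
      P.map Prod.fst = bondPercolation (zdGraph 2) half ∧
      P.map Prod.snd = bondPercolation (zdGraph 2) half ∧
      P {p | ε₁ + ε₂ < edist (bondLoopCollection δ 0 (Metric.closedBall 0 R) p.1)
        (bondLoopCollection δ (a + b) (Metric.closedBall 0 R) p.2)} ≤ ε₁ + ε₂ := by
  obtain ⟨P₁, h₁f, h₁s, hd₁⟩ := h₁
  obtain ⟨P₂, h₂f, h₂s, hd₂⟩ := h₂
  have hb : Bornology.IsBounded (Metric.closedBall (0 : ℂ) R) := Metric.isBounded_closedBall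
  haveI : IsProbabilityMeasure P₁ := isProbabilityMeasure_of_map_fst_eq h₁f
  haveI : IsProbabilityMeasure P₂ := isProbabilityMeasure_of_map_fst_eq h₂f
  have hm : ∀ θ : ℝ, Measurable (bondLoopCollection δ θ (Metric.closedBall (0 : ℂ) R)) := fun θ ↦
    measurable_bondLoopCollection hδ θ hb
  have hfin : (Set.range (bondLoopCollection δ a (Metric.closedBall (0 : ℂ) R))).Finite :=
    finite_range_bondLoopCollection hδ a hb
  have hν : P₁.map Prod.snd = P₂.map Prod.fst := by rw [h₁s, h₂f]
  have hrot₁ : ∀ ω, bondLoopCollection δ a (Metric.closedBall (0 : ℂ) R) ω =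
      RandomPlanarGeometry.LoopSpace.rotate a (bondLoopCollection δ 0 (Metric.closedBall (0 : ℂ) R) ω) :=
    fun ω ↦ by rw [← bondLoopCollection_add, add_zero]
  have hrot₂ : ∀ ω, bondLoopCollection δ (a + b) (Metric.closedBall (0 : ℂ) R) ω =
      RandomPlanarGeometry.LoopSpace.rotate a (bondLoopCollection δ b (Metric.closedBall (0 : ℂ) R) ω) :=
    fun ω ↦ bondLoopCollection_add δ a b R ω
  have hset : {p : BondConfig (Site 2) × BondConfig (Site 2) |
      ε₂ < edist (bondLoopCollection δ a (Metric.closedBall (0 : ℂ) R) p.1)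
        (bondLoopCollection δ (a + b) (Metric.closedBall (0 : ℂ) R) p.2)} =
      {p | ε₂ < edist (bondLoopCollection δ 0 (Metric.closedBall (0 : ℂ) R) p.1)
        (bondLoopCollection δ b (Metric.closedBall (0 : ℂ) R) p.2)} := by
    ext p
    simp only [mem_setOf_eq]
    rw [hrot₁ p.1, hrot₂ p.2, (RandomPlanarGeometry.LoopSpace.isometry_rotate a).edist_eq]
  obtain ⟨Q, hQfst, hQsnd, hQ⟩ := exists_glueCoupling P₁ P₂ (hm a) hfin hν
  refine ⟨Q, ?_, ?_, ?_⟩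
  · rw [hQfst, h₁f]
  · rw [hQsnd, h₂s]
  · refine (hQ (hm 0) (hm (a + b)) ε₁ ε₂).trans (add_le_add hd₁ ?_)
    rw [hset]; exact hd₂

/-- **DKKMO Theorem 1.2 (`q = 1`) in the coupling form of eq. (2), from Theorem 1.7**
(Duminil-Copin–Kozlowski–Krachun–Manolescu–Oulamara, arXiv:2012.11672: v2 (2026) Theorem 1.2,
"for any `α ∈ [0, 2π]` and `δ > 0`, `d_CN(φ_{δℤ²}, φ_{e^{iα}δℤ²}) ≤ C δ^c`", with `d_CN` on laws
the coupling distance of eq. (2), `inf {ε : ∃ coupling ℙ of φ, φ' with ℙ[d_CN(ω, ω') > ε] < ε}`;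
derived from Theorem 1.7 as in v2 Remark 1.8 / v1 §7.1 "Proof of Theorem 1.2, case `Ω = ℝ²`").
Given the coupling form of Theorem 1.7 at `q = 1` (`dkkmo_universality_coupling`: `φ_{δL(θ)}`
and `φ_{δL(π/2)}` couple with loop collections `C δ^c`-close off a set of mass `C δ^c`,
uniformly in `θ ∈ (0, π)`): for every window radius `R` there are `C'`, `c > 0` such that for
every real angle `α` and mesh `δ ∈ (0, 1]` two critical bond percolations `ω, ω'` on `ℤ²` couple
so that the collections of interface loops of `ω` on `δℤ²` and of `ω'` on `δ e^{iα} ℤ²` inside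
`closedBall 0 R` (same conventions as crit-perc.S25: based oriented loop classes, hard centred
window, Hausdorff edistance on `LoopSpace ℂ`) are at edistance `> C' δ^c` with probability
`≤ C' δ^c`; here `C' = 6 max(C, 0)`. For `θ ∈ (0, π)` the base coupling
`rotationCoupling_of_isoRect` (two glued copies of Theorem 1.7 transported by the exact
symmetries `S_{θ/2}` of `φ_{L(θ)}` and `S_0` of `φ_{L(π/2)}`; mesh `δ = δ'/√2`) has defect
`2Cδ^c`; an arbitrary real angle `α` is, modulo `2π`, three times an angle of
`(0, 2π/3] ⊂ (0, π)`, and three base couplings glue (`rotationCoupling_add`) to one of defect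
`6 C δ^c ≤ 6 C δ'^c`. No hypothesis other than Theorem 1.7; combined with
`dkkmo_rotation_invariance_of_coupling` it gives crit-perc.S25 (as does, directly at the level
of laws, `dkkmo_rotation_invariance_of_universality`). [cite: arXiv201211672v2, Thm 1.2, eq. (2), Remark 1.8] -/
theorem dkkmo_coupling_of_universality (hU : dkkmo_universality_coupling) :
    ∀ (R : ℝ),
      ∃ C c : ℝ, 0 < c ∧ ∀ α : ℝ, ∀ δ ∈ Set.Ioc (0 : ℝ) 1,
        ∃ P : Measure (BondConfig (Site 2) × BondConfig (Site 2)),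
          P.map Prod.fst = bondPercolation (zdGraph 2) half ∧
          P.map Prod.snd = bondPercolation (zdGraph 2) half ∧
          P {p | ENNReal.ofReal (C * δ ^ c) <
              edist (bondLoopCollection δ 0 (Metric.closedBall 0 R) p.1)
                (bondLoopCollection δ α (Metric.closedBall 0 R) p.2)} ≤
            ENNReal.ofReal (C * δ ^ c) := by
  intro R
  obtain ⟨C, c, hc, H⟩ := hU R
  refine ⟨6 * max C 0, c, hc, fun α δ' hδ' ↦ ?_⟩
  -- Step 0: the mesh `δ = δ'/√2` of the isoradial picture.
  have hs2 : 0 < Real.sqrt 2 := Real.sqrt_pos.2 (by norm_num)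
  have hs2' : (1 : ℝ) ≤ Real.sqrt 2 := Real.one_le_sqrt.2 (by norm_num)
  have hδpos : 0 < δ' / Real.sqrt 2 := div_pos hδ'.1 hs2
  have hδle : δ' / Real.sqrt 2 ≤ δ' := div_le_self hδ'.1.le hs2'
  have hδ : δ' / Real.sqrt 2 ∈ Set.Ioc (0 : ℝ) 1 := ⟨hδpos, hδle.trans hδ'.2⟩
  have hδ'eq : Real.sqrt 2 * (δ' / Real.sqrt 2) = δ' := by field_simp
  -- Step 1: base couplings for every `θ ∈ (0, π)`, defect `2ε` with `ε = max(C,0) δ^c`.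
  have base : ∀ θ ∈ Set.Ioo (0 : ℝ) π, ∃ P : Measure (BondConfig (Site 2) × BondConfig (Site 2)),
      P.map Prod.fst = bondPercolation (zdGraph 2) half ∧
      P.map Prod.snd = bondPercolation (zdGraph 2) half ∧
      P {p | ENNReal.ofReal (max C 0 * (δ' / Real.sqrt 2) ^ c) + ENNReal.ofReal (max C 0 * (δ' / Real.sqrt 2) ^ c) <
          edist (bondLoopCollection δ' 0 (Metric.closedBall 0 R) p.1)
            (bondLoopCollection δ' θ (Metric.closedBall 0 R) p.2)} ≤
        ENNReal.ofReal (max C 0 * (δ' / Real.sqrt 2) ^ c) + ENNReal.ofReal (max C 0 * (δ' / Real.sqrt 2) ^ c) := by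
    intro θ hθ
    obtain ⟨P, h₁, h₂, hP⟩ := H θ hθ _ hδ
    have hCle : ENNReal.ofReal (C * (δ' / Real.sqrt 2) ^ c) ≤
        ENNReal.ofReal (max C 0 * (δ' / Real.sqrt 2) ^ c) :=
      ENNReal.ofReal_le_ofReal (mul_le_mul_of_nonneg_right (le_max_left _ _) (Real.rpow_nonneg hδpos.le _))
    have key := rotationCoupling_of_isoRect hδpos hθ R ⟨P, h₁, h₂,
      (measure_mono fun p hp ↦ lt_of_le_of_lt hCle hp).trans (hP.trans hCle)⟩
    rwa [hδ'eq] at key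
  -- Step 2: reduce the angle modulo `2π` into `(0, 2π]` and cut it in three.
  have hmem : toIocMod Real.two_pi_pos 0 α ∈ Set.Ioc 0 (0 + 2 * π) := toIocMod_mem_Ioc Real.two_pi_pos 0 α
  have hper : α = toIocMod Real.two_pi_pos 0 α + (toIocDiv Real.two_pi_pos 0 α : ℝ) * (2 * π) := by
    have h := (toIocMod_add_toIocDiv_zsmul Real.two_pi_pos 0 α).symm
    rwa [zsmul_eq_mul] at h
  generalize toIocMod Real.two_pi_pos 0 α = α₀ at hmem hper
  have hθ : α₀ / 3 ∈ Set.Ioo (0 : ℝ) π := by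
    constructor
    · linarith [hmem.1]
    · linarith [hmem.2, Real.pi_pos]
  have hcong : bondLoopCollection δ' α (Metric.closedBall (0 : ℂ) R) =
      bondLoopCollection δ' (α₀ / 3 + α₀ / 3 + α₀ / 3) (Metric.closedBall 0 R) := by
    refine bondLoopCollection_congr (Circle.exp_eq_exp.2 ⟨toIocDiv Real.two_pi_pos 0 α, ?_⟩) _
    rw [show α₀ / 3 + α₀ / 3 + α₀ / 3 = α₀ by ring]
    exact hper
  -- Step 3: glue three base couplings.
  obtain ⟨P, hPf, hPs, hPd⟩ := rotationCoupling_add hδ'.1 R (α₀ / 3 + α₀ / 3) (α₀ / 3)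
    (rotationCoupling_add hδ'.1 R (α₀ / 3) (α₀ / 3) (base _ hθ) (base _ hθ)) (base _ hθ)
  refine ⟨P, hPf, hPs, ?_⟩
  rw [hcong]
  -- Step 4: constants.
  set ε := ENNReal.ofReal (max C 0 * (δ' / Real.sqrt 2) ^ c) with hεdef
  have h6 : ε + ε + (ε + ε) + (ε + ε) = ENNReal.ofReal (6 * (max C 0 * (δ' / Real.sqrt 2) ^ c)) := by
    rw [ENNReal.ofReal_mul (by norm_num : (0 : ℝ) ≤ 6), ENNReal.ofReal_ofNat, hεdef]; ring
  have hle : ε + ε + (ε + ε) + (ε + ε) ≤ ENNReal.ofReal (6 * max C 0 * δ' ^ c) := by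
    rw [h6]
    refine ENNReal.ofReal_le_ofReal ?_
    rw [mul_assoc]
    refine mul_le_mul_of_nonneg_left ?_ (by norm_num)
    exact mul_le_mul_of_nonneg_left (Real.rpow_le_rpow hδpos.le hδle hc.le) (le_max_right _ _)
  exact (measure_mono fun p hp ↦ lt_of_le_of_lt hle hp).trans (hPd.trans hle)

end CritPerc

end Literature.Probability.Percolation

end
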